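import Mathlib
import Literature.AlgebraicGeometry.Resolution.CobordantBlowupAlgebra
import Summits.ResolutionOfSingularities.ResolutionOfSingularities.Theses.WeightedInvariant

/-!
# `WeightedThesis` — the strict transform of an integral subscheme under a cobordant blow-up is integral

Support lemma for crux `stmt-ResolutionOfSingularities-0569`
(`Summit.ResolutionOfSingularities.ResolutionOfSingularities.Theses.WeightedInvariant.WeightedThesis`),
line `datum-glued-split` (RESHAPE 2), stub `stub_datumToHypersurfaceNonminimal`: the cobordant
tower of that stub must stay inside INTEGRAL (hyper)surfaces, i.e. the strict transform of an
integral closed subscheme must again be integral. Affine statement (Włodarczyk arXiv:2203.03090,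
§3.3: `σˢ(I)` is the schematic closure of `V(I) × 𝔾_m ⊆ B₋ = B ∖ V(t⁻¹)`):

* `cobordantAlgebra.algebraMap_comp_eq` / `algebraMap_polynomial_comp_C` — bookkeeping: `A → 𝒪_B → A[t, t⁻¹]` is
  `A → A[t, t⁻¹]`, and likewise through `A[t]`;
* `cobordantAlgebra.strictTransform_eq_comap` — **the strict transform is a contraction**:
  `σˢ(I) = (I · A[t, t⁻¹]) ∩ 𝒪_B` (`A[t, t⁻¹] = 𝒪_B[1/s]`, `cobordantAlgebra.isLocalization_away_s`);
* `isPrime_map_laurent` — `I · A[t, t⁻¹]` is prime for `I` prime (`(A/I)[t, t⁻¹]` is a domain: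
  `Ideal.isPrime_map_C_iff_isPrime` and localisation at the powers of `t`);
* `stub_isPrime_strictTransform` — **hence `σˢ(I)` is a prime ideal of `𝒪_B` whenever `I` is
  prime**: the strict transform of an integral closed subscheme of `Spec A` is an integral closed
  subscheme of the full cobordant blow-up `B` (possibly supported in the vertex, i.e. empty on
  `B₊`, when `V(I)` lies in the centre).

Valid over any commutative ring `A` and any family `u`, weights `w`. No definition is declared.
-/

noncomputable section

open scoped LaurentPolynomial Polynomial
open LaurentPolynomial
open Literature.AlgebraicGeometry.Resolution

set_option linter.dupNamespace false

namespace Summit.ResolutionOfSingularities.ResolutionOfSingularities.Theorems.WeightedThesis.StrictTransformPrime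

universe u v

variable {A : Type u} [CommRing A] {ι : Type v} (u : ι → A) (w : ι → ℕ)

/-! ## Bookkeeping of structure maps -/

/-- `A → 𝒪_B → A[t, t⁻¹]` is the structure map `a ↦ C a` of the Laurent polynomials. [folklore] -/
theorem cobordantAlgebra.algebraMap_comp_eq :
    (algebraMap (cobordantAlgebra u w) A[T;T⁻¹]).comp (algebraMap A (cobordantAlgebra u w)) =
      algebraMap A A[T;T⁻¹] := by
  refine RingHom.ext fun a => ?_
  rw [RingHom.comp_apply, ← C_eq_algebraMap]
  rfl

/-- `A → A[t] → A[t, t⁻¹]` is the structure map of the Laurent polynomials. [folklore] -/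
theorem algebraMap_polynomial_comp_C :
    (algebraMap A[X] A[T;T⁻¹]).comp (Polynomial.C : A →+* A[X]) = algebraMap A A[T;T⁻¹] := by
  refine RingHom.ext fun a => ?_
  rw [RingHom.comp_apply, algebraMap_eq_toLaurent, Polynomial.toLaurent_C, C_eq_algebraMap]

/-! ## The strict transform is a contraction from `A[t, t⁻¹] = 𝒪_B[1/s]` -/

/-- **`σˢ(I) = (I · A[t, t⁻¹]) ∩ 𝒪_B`**: an element of `𝒪_B` lies in the strict transform of `I`
iff, as a Laurent polynomial, it lies in the extension of `I` to `A[t, t⁻¹]` (the localisation of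
`𝒪_B` at `s = t⁻¹`). [cite: Wlodarczyk2022, §3.3] -/
theorem cobordantAlgebra.strictTransform_eq_comap (I : Ideal A) :
    cobordantAlgebra.strictTransform u w I =
      (I.map (algebraMap A A[T;T⁻¹])).comap (algebraMap (cobordantAlgebra u w) A[T;T⁻¹]) := by
  haveI := cobordantAlgebra.isLocalization_away_s u w
  set B := cobordantAlgebra u w
  set J : Ideal B := I.map (algebraMap A B) with hJ
  have hmap : I.map (algebraMap A A[T;T⁻¹]) = J.map (algebraMap B A[T;T⁻¹]) := by
    rw [hJ, Ideal.map_map, cobordantAlgebra.algebraMap_comp_eq]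
  ext g
  rw [cobordantAlgebra.mem_strictTransform_iff, Ideal.mem_comap, hmap]
  constructor
  · rintro ⟨n, hn⟩
    have hmem : algebraMap B A[T;T⁻¹] (cobordantAlgebra.s u w ^ n * g) ∈
        J.map (algebraMap B A[T;T⁻¹]) := Ideal.mem_map_of_mem _ hn
    rw [map_mul] at hmem
    have hu : IsUnit (algebraMap B A[T;T⁻¹] (cobordantAlgebra.s u w ^ n)) := by
      rw [map_pow]
      exact (IsLocalization.Away.algebraMap_isUnit (S := A[T;T⁻¹]) (cobordantAlgebra.s u w)).pow n
    exact (Ideal.unit_mul_mem_iff_mem _ hu).mp hmem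
  · intro hg
    obtain ⟨⟨⟨j, hj⟩, ⟨m, hm⟩⟩, e⟩ :=
      (IsLocalization.mem_map_algebraMap_iff (Submonoid.powers (cobordantAlgebra.s u w)) A[T;T⁻¹]).mp hg
    obtain ⟨n, rfl⟩ := (Submonoid.mem_powers_iff _ _).mp hm
    refine ⟨n, ?_⟩
    have e' : algebraMap B A[T;T⁻¹] (g * cobordantAlgebra.s u w ^ n) = algebraMap B A[T;T⁻¹] j := by
      simpa [map_mul] using e
    have hinj : Function.Injective (algebraMap B A[T;T⁻¹]) := Subtype.val_injective
    rw [mul_comm, hinj e']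
    exact hj

/-! ## Extensions of prime ideals to Laurent polynomials are prime -/

/-- **`I · A[t, t⁻¹]` is prime for `I` prime**: `I · A[t]` is prime
(`Ideal.isPrime_map_C_iff_isPrime`) and misses the powers of `t` (their top coefficient is
`1 ∉ I`), so its extension to the localisation `A[t, t⁻¹] = A[t][1/t]` is prime. [folklore] -/
theorem isPrime_map_laurent (I : Ideal A) [hI : I.IsPrime] :
    (I.map (algebraMap A A[T;T⁻¹])).IsPrime := by
  have hC : (I.map (Polynomial.C : A →+* A[X])).IsPrime :=
    (Ideal.isPrime_map_C_iff_isPrime I).mpr hI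
  have hdisj : Disjoint (Submonoid.powers (Polynomial.X : A[X]) : Set A[X])
      (I.map (Polynomial.C : A →+* A[X]) : Set A[X]) := by
    rw [Set.disjoint_left]
    rintro _ ⟨n, rfl⟩ hmem
    have h1 : (Polynomial.X ^ n : A[X]).coeff n ∈ I :=
      (Ideal.mem_map_C_iff.mp (by simpa using hmem)) n
    rw [Polynomial.coeff_X_pow_self] at h1
    exact hI.ne_top ((Ideal.eq_top_iff_one I).mpr h1)
  have h := IsLocalization.isPrime_of_isPrime_disjoint (Submonoid.powers (Polynomial.X : A[X]))
    A[T;T⁻¹] (I.map (Polynomial.C : A →+* A[X])) hC hdisj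
  rwa [Ideal.map_map, algebraMap_polynomial_comp_C] at h

/-! ## The strict transform of a prime ideal is prime -/

/-- **The strict transform of a prime ideal under the full cobordant blow-up is prime** (affine
model, any commutative ring, any centre data `(u, w)`): `σˢ(I) = (I · A[t, t⁻¹]) ∩ 𝒪_B` is the
contraction of a prime ideal — so the strict transform of an integral closed subscheme is integral,
which keeps the weighted algorithm inside integral hypersurfaces. [cite: Wlodarczyk2022, §3.3] -/
theorem stub_isPrime_strictTransform :
    ∀ {A : Type} [CommRing A] {m : ℕ} (u : Fin m → A) (w : Fin m → ℕ) (I : Ideal A), I.IsPrime → (Literature.AlgebraicGeometry.Resolution.cobordantAlgebra.strictTransform u w I).IsPrime := by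
  intro A _ m u w I hI
  rw [cobordantAlgebra.strictTransform_eq_comap u w I]
  haveI := isPrime_map_laurent I
  exact Ideal.comap_isPrime _ _

end Summit.ResolutionOfSingularities.ResolutionOfSingularities.Theorems.WeightedThesis.StrictTransformPrime

end
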